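import Mathlib
import Literature.Analysis.FluidPDE.SuitableWeak
import HarnessLib

/-!
# Barrier: a heat-kernel-weighted («Struwe / Giga–Kohn-type») monotonicity functional for
# Navier–Stokes at the VELOCITY level has an infinite square term at every non-stagnation point —
# the weight `|∇log G_{z₀}|² G_{z₀}` is not integrable at the vertex of the parabolic cylinder

Catalogue entry (kind (c), method-level lemma; cell ns-claims, D-0090; technique row «localized
monotonicity functional with the backward heat kernel + blow-up (tangent flow) + rigidity of the limit,
transplanted to NS»), salvage seat ns-claims-salvage-p2 g6. Everything below is PROVED (Gaussian shell
bound + `∫₀ dτ/τ = ∞`), zero fact debt. KERNEL CONTENT ADAPTED VERBATIM-GRADE (namespace and tags only)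
from the refuter kit of record `Summits/NavierStokesRegularity/NavierStokesRegularity/Theorems/
SoloRefuteTaghizadeh2026StepL41Vertex.lean` (ns-claims-refuter-1 g5, p544319 @ a5f4dedfbac5), whose
author is credited for every declaration of §§1–2 below; Literature cannot import Summits (CONVENTIONS §2),
hence the re-declaration under this path. §4 (`lintegral_vtx_parabolicCylinder_eq_top`, the named entry and
its discharge) is this seat's; the kit's Bochner-junk corollaries and the closed form
`∇log G_{z₀}(t,·)(y) = −(y−x₀)/(2ν(t₀−t))` (`hasGradientAt_log_bhk`) stay Summits-side.

technique_class: scale-invariant(-intended) monotonicity functionals `I(r; z₀)` built from the backward heat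
  kernel `G_{z₀}(t,x) = (4πν(t₀−t))^{−3/2} exp(−|x−x₀|²/(4ν(t₀−t)))` centred AT the point under study, whose
  almost-monotonicity `dI/dr ≥ c r⁻¹ D(r; z₀) − C r^α` is driven by a «dissipation square term»
  `D(r; z₀) = ∫∫_{Q_r(z₀)} |∇u − u ⊗ ∇log G_{z₀}|² G_{z₀}` pairing the VELOCITY `u` (dimension L/T) with
  `∇log G_{z₀} = −(x−x₀)/(2ν(t₀−t))` — the Navier–Stokes transplant of Struwe's harmonic-map / Giga–Kohn's
  semilinear-heat monotonicity formulas [cite: GigaKohn1985, §1–§3 (similarity variables, weight ρ = e^{−|y|²/4})].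
blocks: every such inequality (and every blow-up/rigidity argument resting on `D < ∞`) at a point `z₀` where
  the solution does not vanish: for any field with `|u| ≥ m > 0` on a parabolic shell at the vertex,
  `D(r; z₀) = +∞` for EVERY `r > 0`, while `I(r; z₀)` is finite — the printed inequality fails for every
  smooth finite-energy solution at every non-stagnation point (instance of record: D-0090 claims map row
  C166 `Taghizadeh2026`, ADJUDICATED #153, head `Literature.Claims.NS.Taghizadeh2026.Step29E_AlmostMono`,
  kernel object `Summit.….Theorems.Taghizadeh2026.not_Step29E` p546174) [cite: Taghizadeh2026, §2.9 p.6 l.36–56; §2.4 p.4 l.80 – p.5 l.15].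
because: `|∇log G_{z₀}|² G_{z₀} = ‖x−x₀‖²/(4ν²(t₀−t)²)·G_{z₀}`; on the shell
  `ν(t₀−t)/4 ≤ ‖x−x₀‖² ≤ ν(t₀−t)` each time slice of its integral is `≥ C₀/(ν(t₀−t))` (exact value over
  `ℝ³`: `3/(2ν(t₀−t))` — the Gaussian second moment), and `∫₀ dτ/τ = ∞` (`lintegral_vtx_core_eq_top`,
  `lintegral_vtx_parabolicCylinder_eq_top`). Dimensional reading: the Giga–Kohn/Struwe square terms pair the
  kernel with DIMENSIONLESS (or correctly rescaled) fields and are finite; `u ⊗ ∇log G` carries an extra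
  `1/(length·time)` that no power of `G` absorbs.
evasions_known: (i) shift the kernel vertex off the cylinder (`G^{(r)}_{z₀}` with vertex at `t₀ + r²`, the
  CKN/Lin normalisation under which «Φ ∼ r⁻³ on Q_r», «|∇Φ| ≲ r⁻⁴» hold): the square term becomes finite,
  but the r⁻³-weighted pieces of such an `I` are then NOT scale-invariant (E-type terms pick up `r³`, flux
  terms `r²` under `u ↦ λu(λx, λ²t)`; `Literature.Barriers.NavierStokesRegularity.ScalingAudit`), so a
  «value persisting across blow-up scales» step has no invariant to persist; (ii) weights paired with
  velocity INCREMENTS `u − u(z₀)` or with `∇u` only (CKN's dimensionless `A, B, C, D`): these are the honest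
  partial-regularity quantities, whose output is `𝒫¹(Sing) = 0`
  (`Literature.Barriers.NavierStokesRegularity.SingularSetDimensionBound`), not an ε-free criterion
  (`Literature.Barriers.NavierStokesRegularity.EnergySupercriticality`).
status: PROVED here (std axioms); instance adjudicated 2026-08-27 (C166 #153).

WHAT THIS IS NOT: not a claim about NS regularity or blow-up; not a claim about any author beyond the typed
locator.
-/

noncomputable section

namespace Literature.Barriers.NavierStokesRegularity

namespace GaussianMonotonicityVertexDivergence

open MeasureTheory Set Metric Real
open scoped ENNReal

/-! ## §1–§2 The vertex weight, the parabolic shell, and the divergence (adapted from the C166 kit,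
ns-claims-refuter-1 g5, p544319) -/

/-- Physical space `ℝ³`. [folklore] -/
abbrev E3 := EuclideanSpace ℝ (Fin 3)

/-- Backward heat kernel with vertex at `z₀ = (t₀, x₀)`, written with `a^{3/2} = a · √a`:
`G(t,x) = exp(-‖x-x₀‖²/(4ν(t₀-t))) / ((4πν(t₀-t)) · √(4πν(t₀-t)))`. [folklore] -/
def bhk (ν : ℝ) (z₀ z : ℝ × E3) : ℝ :=
  Real.exp (-(‖z.2 - z₀.2‖ ^ 2) / (4 * ν * (z₀.1 - z.1))) /
    ((4 * π * ν * (z₀.1 - z.1)) * Real.sqrt (4 * π * ν * (z₀.1 - z.1)))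

/-- The model integrand `|∇ log G_{z₀}|² G_{z₀} = ‖x-x₀‖² / (4ν²(t₀-t)²) · G_{z₀}(t,x)`. [folklore] -/
def vtx (ν : ℝ) (z₀ z : ℝ × E3) : ℝ :=
  ‖z.2 - z₀.2‖ ^ 2 / (4 * ν ^ 2 * (z₀.1 - z.1) ^ 2) * bhk ν z₀ z

/-- The parabolic shell region
`S_T(z₀) = {(t,x) : t₀ - T < t < t₀, ν (t₀ - t)/4 ≤ ‖x - x₀‖² ≤ ν (t₀ - t)}` (away from the axis,
where `∇log G` vanishes, and inside `{s ≤ 1}` for `T ≤ r²/(1+ν)`). [folklore] -/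
def core (ν T : ℝ) (z₀ : ℝ × E3) : Set (ℝ × E3) :=
  {z | z₀.1 - T < z.1 ∧ z.1 < z₀.1 ∧ ν * (z₀.1 - z.1) / 4 ≤ ‖z.2 - z₀.2‖ ^ 2 ∧
    ‖z.2 - z₀.2‖ ^ 2 ≤ ν * (z₀.1 - z.1)}

/-- The shell constant `C₀ = (1/16) · (1/(8π√π)) · e^{-1/4} · (7π/6) > 0`. [folklore] -/
def C0 : ℝ := 1 / 16 * (1 / (8 * π * Real.sqrt π)) * Real.exp (-1 / 4) * (7 * π / 6)

/-- The shell constant is positive. [folklore] -/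
private lemma C0_pos : 0 < C0 := by
  unfold C0; positivity

/-- The kernel is nonnegative below the vertex time. [folklore] -/
private lemma bhk_nonneg {ν : ℝ} (hν : 0 < ν) {z₀ z : ℝ × E3} (ht : z.1 < z₀.1) : 0 ≤ bhk ν z₀ z := by
  unfold bhk
  have : 0 < z₀.1 - z.1 := by linarith
  positivity

/-- The model integrand is nonnegative below the vertex time. [folklore] -/
private lemma vtx_nonneg {ν : ℝ} (hν : 0 < ν) {z₀ z : ℝ × E3} (ht : z.1 < z₀.1) : 0 ≤ vtx ν z₀ z := by
  unfold vtx
  have := bhk_nonneg hν (z₀ := z₀) ht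
  positivity

/-- The model integrand is measurable. [folklore] -/
private lemma measurable_vtx (ν : ℝ) (z₀ : ℝ × E3) : Measurable (vtx ν z₀) := by
  unfold vtx bhk
  fun_prop

/-- The shell region is measurable. [folklore] -/
private lemma measurableSet_core (ν T : ℝ) (z₀ : ℝ × E3) : MeasurableSet (core ν T z₀) := by
  unfold core
  have h1 : Measurable fun z : ℝ × E3 => z.1 := measurable_fst
  have h2 : Measurable fun z : ℝ × E3 => ‖z.2 - z₀.2‖ ^ 2 :=
    ((measurable_snd.sub_const _).norm).pow_const _
  have h3 : Measurable fun z : ℝ × E3 => ν * (z₀.1 - z.1) :=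
    (measurable_const.sub measurable_fst).const_mul _
  have h4 : Measurable fun z : ℝ × E3 => ν * (z₀.1 - z.1) / 4 := h3.div_const _
  exact (measurableSet_lt measurable_const h1).inter
    ((measurableSet_lt h1 measurable_const).inter
      ((measurableSet_le h4 h2).inter (measurableSet_le h2 h3)))

/-- Pointwise lower bound on the shell `ρ/2 ≤ ‖x - x₀‖ ≤ ρ`, `ρ = √(ν(t₀-t))`:
`vtx ≥ (1/(16ρ²)) · (1/(8π√π ρ³)) · e^{-1/4}`. [folklore] -/
private lemma vtx_ge_on_shell {ν : ℝ} (hν : 0 < ν) {z₀ : ℝ × E3} {t : ℝ} (ht : t < z₀.1)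
    {x : E3} (hlo : Real.sqrt (ν * (z₀.1 - t)) / 2 ≤ ‖x - z₀.2‖)
    (hhi : ‖x - z₀.2‖ ≤ Real.sqrt (ν * (z₀.1 - t))) :
    1 / (16 * (Real.sqrt (ν * (z₀.1 - t))) ^ 2) *
        (1 / (8 * π * Real.sqrt π * (Real.sqrt (ν * (z₀.1 - t))) ^ 3)) * Real.exp (-1 / 4)
      ≤ vtx ν z₀ (t, x) := by
  set τ := z₀.1 - t with hτdef
  have hτ : 0 < τ := by simp [hτdef]; linarith
  set ρ := Real.sqrt (ν * τ) with hρdef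
  have hντ : 0 < ν * τ := mul_pos hν hτ
  have hρ : 0 < ρ := Real.sqrt_pos.mpr hντ
  have hρ2 : ρ ^ 2 = ν * τ := Real.sq_sqrt hντ.le
  set d := ‖x - z₀.2‖ with hd
  have hd0 : 0 ≤ d := norm_nonneg _
  -- rewrite vtx in terms of ρ and d
  have hsqrt : Real.sqrt (4 * π * ν * τ) = 2 * ρ * Real.sqrt π := by
    rw [show 4 * π * ν * τ = (2 * ρ) ^ 2 * π by rw [mul_pow, hρ2]; ring]
    rw [Real.sqrt_mul (by positivity), Real.sqrt_sq (by positivity)]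
  have hv : vtx ν z₀ (t, x) =
      d ^ 2 / (4 * ρ ^ 4) * (Real.exp (-(d ^ 2) / (4 * ρ ^ 2)) / ((4 * π * ρ ^ 2) * (2 * ρ * Real.sqrt π))) := by
    unfold vtx bhk
    simp only
    rw [← hτdef, ← hd, hsqrt]
    rw [show 4 * ν ^ 2 * τ ^ 2 = 4 * ρ ^ 4 by rw [show ρ ^ 4 = (ρ ^ 2) ^ 2 by ring, hρ2]; ring]
    rw [show 4 * ν * τ = 4 * ρ ^ 2 by rw [hρ2]; ring]
    rw [show 4 * π * ν * τ = 4 * π * ρ ^ 2 by rw [hρ2]; ring]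
  rw [hv]
  -- factor bounds
  have h1 : 1 / (16 * ρ ^ 2) ≤ d ^ 2 / (4 * ρ ^ 4) := by
    have : (ρ / 2) ^ 2 ≤ d ^ 2 := by
      exact pow_le_pow_left₀ (by positivity) hlo 2
    rw [div_le_div_iff₀ (by positivity) (by positivity)]
    nlinarith [this, hρ.le, pow_pos hρ 2, pow_pos hρ 4]
  have h2 : Real.exp (-1 / 4) ≤ Real.exp (-(d ^ 2) / (4 * ρ ^ 2)) := by
    apply Real.exp_le_exp.mpr
    have hd2 : d ^ 2 ≤ ρ ^ 2 := pow_le_pow_left₀ hd0 hhi 2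
    rw [div_le_div_iff₀ (by norm_num) (by positivity)]
    nlinarith [hd2, pow_pos hρ 2]
  have h3 : 1 / (8 * π * Real.sqrt π * ρ ^ 3) =
      1 / ((4 * π * ρ ^ 2) * (2 * ρ * Real.sqrt π)) := by
    congr 1; ring
  calc 1 / (16 * ρ ^ 2) * (1 / (8 * π * Real.sqrt π * ρ ^ 3)) * Real.exp (-1 / 4)
      = 1 / (16 * ρ ^ 2) * (Real.exp (-1 / 4) / ((4 * π * ρ ^ 2) * (2 * ρ * Real.sqrt π))) := by
        rw [h3]; ring
    _ ≤ d ^ 2 / (4 * ρ ^ 4) * (Real.exp (-(d ^ 2) / (4 * ρ ^ 2)) / ((4 * π * ρ ^ 2) * (2 * ρ * Real.sqrt π))) := by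
        gcongr

/-- Volume of the shell `closedBall x₀ ρ \ ball x₀ (ρ/2)` in `ℝ³`: `(ρ³ - (ρ/2)³) · 4π/3`. [folklore] -/
private lemma volume_shell (x₀ : E3) {ρ : ℝ} (hρ : 0 ≤ ρ) :
    volume (closedBall x₀ ρ \ ball x₀ (ρ / 2)) =
      ENNReal.ofReal ((ρ ^ 3 - (ρ / 2) ^ 3) * (π * 4 / 3)) := by
  rw [measure_sdiff (ball_subset_closedBall.trans (closedBall_subset_closedBall (by linarith)))
    measurableSet_ball.nullMeasurableSet (measure_ball_lt_top).ne]
  rw [EuclideanSpace.volume_closedBall_fin_three, EuclideanSpace.volume_ball_fin_three]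
  rw [← ENNReal.ofReal_pow hρ, ← ENNReal.ofReal_pow (by positivity),
    ← ENNReal.ofReal_mul (by positivity), ← ENNReal.ofReal_mul (by positivity),
    ← ENNReal.ofReal_sub _ (by positivity)]
  congr 1; ring

/-- Slice bound: for `t₀ - T < t < t₀`, the inner `x`-integral of the indicator of the core
region is at least `C₀ / (ν (t₀ - t))`. [folklore] -/
private lemma slice_bound {ν T : ℝ} (hν : 0 < ν) (z₀ : ℝ × E3) {t : ℝ} (ht : t ∈ Ioo (z₀.1 - T) z₀.1) :
    ENNReal.ofReal (C0 / (ν * (z₀.1 - t))) ≤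
      ∫⁻ x, (core ν T z₀).indicator (fun z => ENNReal.ofReal (vtx ν z₀ z)) (t, x) := by
  set τ := z₀.1 - t with hτdef
  have hτ : 0 < τ := by simp [hτdef]; linarith [ht.2]
  set ρ := Real.sqrt (ν * τ) with hρdef
  have hντ : 0 < ν * τ := mul_pos hν hτ
  have hρ : 0 < ρ := Real.sqrt_pos.mpr hντ
  have hρ2 : ρ ^ 2 = ν * τ := Real.sq_sqrt hντ.le
  set L : ℝ := 1 / (16 * ρ ^ 2) * (1 / (8 * π * Real.sqrt π * ρ ^ 3)) * Real.exp (-1 / 4) with hL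
  have hL0 : 0 ≤ L := by positivity
  set A := closedBall z₀.2 ρ \ ball z₀.2 (ρ / 2) with hA
  have hAm : MeasurableSet A := measurableSet_closedBall.diff measurableSet_ball
  -- pointwise: on A the indicator equals ofReal vtx ≥ ofReal L
  have hpt : ∀ x, A.indicator (fun _ => ENNReal.ofReal L) x ≤
      (core ν T z₀).indicator (fun z => ENNReal.ofReal (vtx ν z₀ z)) (t, x) := by
    intro x
    by_cases hx : x ∈ A
    · have hhi : ‖x - z₀.2‖ ≤ ρ := by
        have := hx.1; rw [mem_closedBall, dist_eq_norm] at this; exact this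
      have hlo : ρ / 2 ≤ ‖x - z₀.2‖ := by
        have := hx.2; rw [mem_ball, dist_eq_norm, not_lt] at this; exact this
      have hmem : ((t, x) : ℝ × E3) ∈ core ν T z₀ := by
        refine ⟨ht.1, ht.2, ?_, ?_⟩
        · simp only
          rw [← hτdef, ← hρ2]
          have h4 : (ρ / 2) ^ 2 ≤ ‖x - z₀.2‖ ^ 2 := pow_le_pow_left₀ (by positivity) hlo 2
          linarith [h4]
        · simp only
          rw [← hτdef, ← hρ2]
          exact pow_le_pow_left₀ (norm_nonneg _) hhi 2
      rw [indicator_of_mem hx, indicator_of_mem hmem]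
      exact ENNReal.ofReal_le_ofReal (vtx_ge_on_shell hν ht.2 hlo hhi)
    · rw [indicator_of_notMem hx]; exact bot_le
  calc ENNReal.ofReal (C0 / (ν * τ))
      = ENNReal.ofReal L * volume A := by
        rw [hA, volume_shell z₀.2 hρ.le, ← ENNReal.ofReal_mul hL0]
        congr 1
        rw [hL, ← hρ2, C0]
        field_simp
        ring
    _ = ∫⁻ x, A.indicator (fun _ => ENNReal.ofReal L) x := (lintegral_indicator_const hAm _).symm
    _ ≤ _ := lintegral_mono hpt

/-- `∫⁻_{(t₀-T, t₀)} ofReal (C₀/(ν (t₀ - t))) dt = ⊤` (`1/τ` is not integrable at `0`). [folklore] -/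
private lemma lintegral_time_eq_top {ν T : ℝ} (hν : 0 < ν) (hT : 0 < T) (t₀ : ℝ) :
    ∫⁻ t in Ioo (t₀ - T) t₀, ENNReal.ofReal (C0 / (ν * (t₀ - t))) = ⊤ := by
  have key : ∫⁻ t in Ioo (t₀ - T) t₀, ENNReal.ofReal ((t₀ - t)⁻¹) = ⊤ := by
    by_contra h
    have hint : IntegrableOn (fun t => (t₀ - t)⁻¹) (Ioo (t₀ - T) t₀) := by
      refine ⟨by fun_prop, ?_⟩
      rw [HasFiniteIntegral]
      calc ∫⁻ t in Ioo (t₀ - T) t₀, ‖(t₀ - t)⁻¹‖ₑ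
          = ∫⁻ t in Ioo (t₀ - T) t₀, ENNReal.ofReal ((t₀ - t)⁻¹) := by
            refine setLIntegral_congr_fun measurableSet_Ioo (fun t ht => ?_)
            rw [Real.enorm_eq_ofReal (inv_nonneg.mpr (by linarith [ht.2]))]
        _ < ⊤ := lt_top_iff_ne_top.mpr h
    have hii : IntervalIntegrable (fun t => (t - t₀)⁻¹) volume (t₀ - T) t₀ := by
      rw [intervalIntegrable_iff_integrableOn_Ioo_of_le (by linarith)]
      refine (hint.neg).congr_fun (fun t _ => ?_) measurableSet_Ioo
      simp only [Pi.neg_apply]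
      rw [← inv_neg, neg_sub]
    rcases intervalIntegrable_sub_inv_iff.mp hii with h2 | h2
    · linarith
    · exact h2 right_mem_uIcc
  have hc : ENNReal.ofReal (C0 / ν) ≠ 0 := by
    have := C0_pos; positivity
  calc ∫⁻ t in Ioo (t₀ - T) t₀, ENNReal.ofReal (C0 / (ν * (t₀ - t)))
      = ∫⁻ t in Ioo (t₀ - T) t₀, ENNReal.ofReal (C0 / ν) * ENNReal.ofReal ((t₀ - t)⁻¹) := by
        refine setLIntegral_congr_fun measurableSet_Ioo (fun t ht => ?_)
        rw [← ENNReal.ofReal_mul (by have := C0_pos; positivity)]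
        congr 1
        field_simp
    _ = ENNReal.ofReal (C0 / ν) * ∫⁻ t in Ioo (t₀ - T) t₀, ENNReal.ofReal ((t₀ - t)⁻¹) :=
        lintegral_const_mul' _ _ ENNReal.ofReal_ne_top
    _ = ⊤ := by rw [key, ENNReal.mul_top hc]

/-- **Vertex divergence.** `∫⁻_{S_T(z₀)} ofReal (|∇log G_{z₀}|² G_{z₀}) = ⊤` for all `ν, T > 0`.  [cite: Taghizadeh2026, §2.4 p.4 l.80–88 and §2.9 p.6 l.36–47] [cite: GigaKohn1985, §1 (backward-similarity Gaussian weight)] -/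
theorem lintegral_vtx_core_eq_top {ν T : ℝ} (hν : 0 < ν) (hT : 0 < T) (z₀ : ℝ × E3) :
    ∫⁻ z in core ν T z₀, ENNReal.ofReal (vtx ν z₀ z) = ⊤ := by
  have hS := measurableSet_core ν T z₀
  have hF : Measurable (fun z => ENNReal.ofReal (vtx ν z₀ z)) :=
    ENNReal.measurable_ofReal.comp (measurable_vtx ν z₀)
  rw [← lintegral_indicator hS, Measure.volume_eq_prod, lintegral_prod _ (hF.indicator hS).aemeasurable]
  refine eq_top_iff.mpr ?_
  calc (⊤ : ℝ≥0∞) = ∫⁻ t in Ioo (z₀.1 - T) z₀.1, ENNReal.ofReal (C0 / (ν * (z₀.1 - t))) :=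
        (lintegral_time_eq_top hν hT z₀.1).symm
    _ = ∫⁻ t, (Ioo (z₀.1 - T) z₀.1).indicator
          (fun t => ENNReal.ofReal (C0 / (ν * (z₀.1 - t)))) t := (lintegral_indicator measurableSet_Ioo _).symm
    _ ≤ ∫⁻ t, ∫⁻ x, (core ν T z₀).indicator (fun z => ENNReal.ofReal (vtx ν z₀ z)) (t, x) := by
        refine lintegral_mono (fun t => ?_)
        by_cases ht : t ∈ Ioo (z₀.1 - T) z₀.1
        · rw [indicator_of_mem ht]; exact slice_bound hν z₀ ht
        · rw [indicator_of_notMem ht]; exact bot_le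

/-- Monotone extension: any `ℝ≥0∞`-integrand dominating `ofReal (c · vtx)` on the core region,
`c > 0`, over any larger set, has integral `⊤`.  [cite: Taghizadeh2026, §2.9 p.6 l.36–47] -/
theorem lintegral_eq_top_of_ge {ν T c : ℝ} (hν : 0 < ν) (hT : 0 < T) (hc : 0 < c) (z₀ : ℝ × E3)
    {Q : Set (ℝ × E3)} (hQ : core ν T z₀ ⊆ Q) {F : ℝ × E3 → ℝ≥0∞}
    (hF : ∀ z ∈ core ν T z₀, ENNReal.ofReal (c * vtx ν z₀ z) ≤ F z) :
    ∫⁻ z in Q, F z = ⊤ := by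
  refine eq_top_iff.mpr ?_
  calc (⊤ : ℝ≥0∞) = ENNReal.ofReal c * ∫⁻ z in core ν T z₀, ENNReal.ofReal (vtx ν z₀ z) := by
        rw [lintegral_vtx_core_eq_top hν hT z₀, ENNReal.mul_top (by positivity)]
    _ = ∫⁻ z in core ν T z₀, ENNReal.ofReal (c * vtx ν z₀ z) := by
        rw [← lintegral_const_mul' _ _ ENNReal.ofReal_ne_top]
        refine setLIntegral_congr_fun (measurableSet_core ν T z₀) (fun z hz => ?_)
        rw [ENNReal.ofReal_mul hc.le]
    _ ≤ ∫⁻ z in core ν T z₀, F z := by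
        refine lintegral_mono_ae ?_
        exact (ae_restrict_iff' (measurableSet_core ν T z₀)).mpr (ae_of_all _ hF)
    _ ≤ ∫⁻ z in Q, F z := lintegral_mono_set hQ

/-- The core region sits inside the tree's backward parabolic cylinder `Q_r(z₀)` as soon as
`T ≤ r²` and `ν T < r²`… we record the elementary inclusion in the form needed:
for `z ∈ S_T(z₀)` with `T ≤ r ^ 2 / (1 + ν)`: `t₀ - r² < t < t₀`, `‖x - x₀‖ < r`, and the
normalised parabolic distance `s = (‖x-x₀‖² + (t₀ - t))/r² ≤ 1`. [folklore] -/
private lemma core_bounds {ν T r : ℝ} (hν : 0 < ν) (hr : 0 < r) (hT : T ≤ r ^ 2 / (1 + ν))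
    {z₀ z : ℝ × E3} (hz : z ∈ core ν T z₀) :
    z₀.1 - r ^ 2 < z.1 ∧ z.1 < z₀.1 ∧ ‖z.2 - z₀.2‖ < r ∧
      ‖z.2 - z₀.2‖ ^ 2 + (z₀.1 - z.1) ≤ r ^ 2 := by
  obtain ⟨h1, h2, -, h3⟩ := hz
  have hτ : 0 < z₀.1 - z.1 := by linarith
  have hTle : T ≤ r ^ 2 := by
    have : r ^ 2 / (1 + ν) ≤ r ^ 2 := div_le_self (by positivity) (by linarith)
    linarith
  have hτT : z₀.1 - z.1 < T := by linarith
  have hsum : ‖z.2 - z₀.2‖ ^ 2 + (z₀.1 - z.1) ≤ r ^ 2 := by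
    have : (1 + ν) * (z₀.1 - z.1) ≤ r ^ 2 := by
      have h' : (z₀.1 - z.1) ≤ r ^ 2 / (1 + ν) := by linarith
      have := (le_div_iff₀ (by positivity : (0:ℝ) < 1 + ν)).mp h'
      linarith [this]
    nlinarith [h3, this]
  refine ⟨by linarith, h2, ?_, hsum⟩
  have hlt : ‖z.2 - z₀.2‖ ^ 2 < r ^ 2 := by nlinarith [hsum, hτ]
  by_contra h
  rw [not_lt] at h
  nlinarith [h, norm_nonneg (z.2 - z₀.2), hr]

/-! ## §4 The divergence on the tree's parabolic cylinder and the named entry (this seat) -/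

open Literature.Analysis.FluidPDE in
/-- **The weight is not integrable on ANY backward parabolic cylinder at its vertex**:
`∫⁻_{Q_r(z₀)} |∇log G_{z₀}|² G_{z₀} = ⊤` for all `ν, r > 0` (the shell `S_T(z₀)`, `T = r²/(1+ν)`, lies in
`Q_r(z₀) = (t₀ − r², t₀) × B_r(x₀)` by `core_bounds`). [cite: Taghizadeh2026, §2.9 p.6 l.36–47] [cite: CKN1982, §2 (parabolic cylinders)] -/
theorem lintegral_vtx_parabolicCylinder_eq_top {ν r : ℝ} (hν : 0 < ν) (hr : 0 < r) (z₀ : ℝ × E3) :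
    ∫⁻ z in parabolicCylinder r z₀, ENNReal.ofReal (vtx ν z₀ z) = ⊤ := by
  have hT : 0 < r ^ 2 / (1 + ν) := by positivity
  refine lintegral_eq_top_of_ge hν hT one_pos z₀ (Q := parabolicCylinder r z₀) ?_ ?_
  · intro z hz
    obtain ⟨h1, h2, h3, -⟩ := core_bounds hν hr le_rfl hz
    rw [mem_parabolicCylinder]
    exact ⟨⟨h1, h2⟩, by rwa [dist_eq_norm]⟩
  · intro z _
    rw [one_mul]

open Literature.Analysis.FluidPDE in
/-- **A velocity-level square term is infinite at a non-stagnation vertex**: if a field `u` has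
`‖u‖ ≥ m > 0` on the shell `S_T(z₀)`, `T = r²/(1+ν)` (e.g. `u` continuous at `z₀` with `u(z₀) ≠ 0` and `r`
small), then `∫⁻_{Q_r(z₀)} ‖u‖² |∇log G_{z₀}|² G_{z₀} = ⊤`. [cite: Taghizadeh2026, §2.9 p.6 l.36–47; §3.1 p.7 l.26–38] -/
theorem lintegral_normSq_mul_vtx_parabolicCylinder_eq_top {ν r m : ℝ} (hν : 0 < ν) (hr : 0 < r)
    (hm : 0 < m) (z₀ : ℝ × E3) {u : ℝ × E3 → E3}
    (hu : ∀ z ∈ core ν (r ^ 2 / (1 + ν)) z₀, m ≤ ‖u z‖) :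
    ∫⁻ z in parabolicCylinder r z₀, ENNReal.ofReal (‖u z‖ ^ 2 * vtx ν z₀ z) = ⊤ := by
  have hT : 0 < r ^ 2 / (1 + ν) := by positivity
  refine lintegral_eq_top_of_ge hν hT (pow_pos hm 2) z₀ (Q := parabolicCylinder r z₀) ?_ ?_
  · intro z hz
    obtain ⟨h1, h2, h3, -⟩ := core_bounds hν hr le_rfl hz
    rw [mem_parabolicCylinder]
    exact ⟨⟨h1, h2⟩, by rwa [dist_eq_norm]⟩
  · intro z hz
    refine ENNReal.ofReal_le_ofReal (mul_le_mul_of_nonneg_right ?_ (vtx_nonneg hν hz.2.1))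
    exact pow_le_pow_left₀ hm.le (hu z hz) 2

end GaussianMonotonicityVertexDivergence

open GaussianMonotonicityVertexDivergence Literature.Analysis.FluidPDE in
/-- **Barrier (named record): the Gaussian-weighted velocity-level monotonicity square term diverges at the
vertex.** For every `ν > 0`, every `r > 0` and every space-time point `z₀`, the model weight
`|∇log G_{z₀}|² G_{z₀}` has infinite integral over the backward parabolic cylinder `Q_r(z₀)`; hence any field
bounded below in norm near `z₀` gives an infinite square term `∫∫_{Q_r(z₀)} ‖u‖²|∇log G_{z₀}|²G_{z₀}`.
technique_class / blocks / because / evasions_known / status: see the module docstring.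
[cite: Taghizadeh2026, §2.9 p.6 l.36–56] [cite: GigaKohn1985, §1–§3] -/
def GaussianMonotonicityVertexDivergence : Prop :=
  ∀ ⦃ν r : ℝ⦄, 0 < ν → 0 < r → ∀ z₀ : ℝ × EuclideanSpace ℝ (Fin 3),
    (∫⁻ z in parabolicCylinder r z₀, ENNReal.ofReal (vtx ν z₀ z) = ⊤) ∧
    ∀ ⦃m : ℝ⦄, 0 < m → ∀ u : ℝ × EuclideanSpace ℝ (Fin 3) → EuclideanSpace ℝ (Fin 3),
      (∀ z ∈ core ν (r ^ 2 / (1 + ν)) z₀, m ≤ ‖u z‖) →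
        ∫⁻ z in parabolicCylinder r z₀, ENNReal.ofReal (‖u z‖ ^ 2 * vtx ν z₀ z) = ⊤

open GaussianMonotonicityVertexDivergence in
/-- The barrier record holds (kernel, standard axioms). [cite: Taghizadeh2026, §2.9 p.6 l.36–56] -/
theorem gaussianMonotonicityVertexDivergence_holds : GaussianMonotonicityVertexDivergence :=
  fun _ν _r hν hr z₀ =>
    ⟨lintegral_vtx_parabolicCylinder_eq_top hν hr z₀,
      fun _m hm _u hu => lintegral_normSq_mul_vtx_parabolicCylinder_eq_top hν hr hm z₀ hu⟩

end Literature.Barriers.NavierStokesRegularity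

end
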